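import Mathlib
import Summits.NavierStokesRegularity.FluidComputer.TransportGalerkinEmergence
import HarnessLib

/-!
# The transport Galerkin model: the μ-extended level generators are bounded linear maps (instab g17, cell `ns-blowup`, 2026-08-27)

HONEST FRAMING (human ruling D-0035): nothing here is a claim about Navier–Stokes blow-up.
WHAT THIS IS NOT: not NS evidence — typing residue (r1) of `HOME/instab/INSTAB-BRIDGE.md` l.133: the
hypothesis «bounded level generators `A_n` with `A_n w = P_n (linOp (P_n w)) + μ (w − P_n w)`» of
`TransportGalerkinEmergence.half_prediction_nsField` / `decay_two_nsField` is DISCHARGED — such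
`A_n : E →L[ℝ] E` exist (`exists_levelGenerators`): `linOp` is additive and real-homogeneous on
rapidly decreasing elements (§1) and `w ↦ linOp (P_n w)` is bounded by
`K_lin · (∑_{k ∈ cube n} ⟨k⟩² + 1) · ‖w‖` (§2, the two-level cost of `linCoeff` from
`TransportGalerkinContinuity.eNorm_two_linCoeff_le` and the weight ratio on the cube). §3 restates
KEEP/KILL for the model WITHOUT the `A_n` hypothesis (`half_prediction_nsField'`,
`decay_two_nsField'`; the eigen-consistency is stated on `P_n (linOp (P_n v))` directly).
Mathlib + the tree files cited; no new definitions (existence statements only).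
-/

noncomputable section

namespace Summit.NavierStokesRegularity.FluidComputer.TransportGalerkinLevelGenerators

open Set Filter Topology Finset RCLike
open Literature.Analysis.FunctionSpaces Literature.Analysis.FunctionSpaces.Lattice
open Literature.Analysis.FunctionSpaces.Torus Literature.Analysis.ODE
open Summit.NavierStokesRegularity.FluidComputer.GalerkinLatticePhaseSpace
open Summit.NavierStokesRegularity.FluidComputer.TransportGalerkin
open Summit.NavierStokesRegularity.FluidComputer.TransportGalerkinBox
open Summit.NavierStokesRegularity.FluidComputer.TransportSkewLattice
open Summit.NavierStokesRegularity.FluidComputer.TransportGalerkinRapid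
open Summit.NavierStokesRegularity.FluidComputer.TransportGalerkinOneSided
open Summit.NavierStokesRegularity.FluidComputer.TransportGalerkinLipschitz
open Summit.NavierStokesRegularity.FluidComputer.TransportGalerkinContinuity
open Summit.NavierStokesRegularity.FluidComputer.TransportGalerkinEmergence
open Summit.NavierStokesRegularity.FluidComputer.LatticeBoxInterpolation
open scoped ENNReal NNReal ComplexConjugate InnerProductSpace

variable {d : Type*} [Fintype d] [DecidableEq d]
variable {V : Type*} [NormedAddCommGroup V] [InnerProductSpace ℂ V] [CompleteSpace V]
variable {ρ : (d → ℤ) → ℝ} {ν : ℝ} {Uv : (d → ℤ) → V} {π : d → (V →L[ℂ] ℂ)} {P : (d → ℤ) → (V →L[ℂ] V)}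

/-! ## §1 `linOp` is linear on rapidly decreasing elements -/

omit [Fintype d] [DecidableEq d] [CompleteSpace V] in
/-- The scalar symbol of a scaled component family. -/
theorem scal_comp_smul (c : ℂ) (j : d) (u : (d → ℤ) → V) :
    (scal (fun p => π j ((c • u) p)) : (d → ℤ) → (V →L[ℂ] V)) = c • scal (fun p => π j (u p)) := by
  funext k
  simp only [scal_apply, Pi.smul_apply, map_smul, smul_eq_mul, smul_smul]

omit [DecidableEq d] [CompleteSpace V] in
/-- **`linCoeff` is complex-homogeneous** (unconditionally). -/
theorem linCoeff_smul (c : ℂ) (u : (d → ℤ) → V) :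
    linCoeff ν Uv π (c • u) = c • linCoeff ν Uv π u := by
  simp only [linCoeff_eq, smul_sub, Finset.smul_sum, freqDeriv_const_smul, conv_const_smul,
    scal_comp_smul, const_smul_conv, smul_comm (ν : ℂ) c]

omit [DecidableEq d] [CompleteSpace V] in
/-- `linCoeff 0 = 0`. -/
theorem linCoeff_zero : linCoeff ν Uv π (0 : (d → ℤ) → V) = 0 := by
  have h := linCoeff_smul (ν := ν) (Uv := Uv) (π := π) (0 : ℂ) (0 : (d → ℤ) → V)
  rwa [zero_smul, zero_smul] at h

omit [DecidableEq d] in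
/-- **`linCoeff` is additive on rapidly decreasing families** (host rapidly decreasing). -/
theorem linCoeff_add (hUv : RapidDecay Uv) {u v : (d → ℤ) → V} (hu : RapidDecay u) (hv : RapidDecay v) :
    linCoeff ν Uv π (u + v) = linCoeff ν Uv π u + linCoeff ν Uv π v := by
  have h1 := linCoeff_sub (ν := ν) hUv π hu hv.neg'
  have h2 := linCoeff_sub (ν := ν) hUv π rapidDecay_zero hv
  rw [zero_sub, linCoeff_zero, zero_sub] at h2
  rw [sub_neg_eq_add, h2, sub_neg_eq_add] at h1
  exact h1

omit [DecidableEq d] in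
/-- **`linOp` is additive on rapidly decreasing elements.** -/
theorem linOp_add_of_rapidDecay (hUv : RapidDecay Uv) (hPn : ∀ k, ‖P k‖ ≤ 1)
    {x y : lp (fun _ : (d → ℤ) => V) 2} (hx : RapidDecay (⇑x)) (hy : RapidDecay (⇑y)) :
    linOp ν Uv π P (x + y) = linOp ν Uv π P x + linOp ν Uv π P y := by
  have hxy : RapidDecay (⇑(x + y)) := by rw [lp.coeFn_add]; exact hx.add hy
  refine lp.ext ?_
  rw [lp.coeFn_add, coe_linOp_of_rapidDecay hUv hPn hxy, coe_linOp_of_rapidDecay hUv hPn hx,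
    coe_linOp_of_rapidDecay hUv hPn hy, lp.coeFn_add]
  have hadd : wmul (-2) (⇑x + ⇑y) = wmul (-2) ⇑x + wmul (-2) ⇑y := by
    funext k; simp only [wmul_apply, Pi.add_apply, smul_add]
  rw [hadd, linCoeff_add hUv (rapidDecay_wmul hx (-2)) (rapidDecay_wmul hy (-2))]
  funext k
  simp only [wmul_apply, Pi.add_apply, map_add, smul_add]

omit [DecidableEq d] in
/-- **`linOp` is real-homogeneous on rapidly decreasing elements.** -/
theorem linOp_smul_of_rapidDecay (hUv : RapidDecay Uv) (hPn : ∀ k, ‖P k‖ ≤ 1) (r : ℝ)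
    {x : lp (fun _ : (d → ℤ) => V) 2} (hx : RapidDecay (⇑x)) :
    linOp ν Uv π P (r • x) = r • linOp ν Uv π P x := by
  have hrx : RapidDecay (⇑(r • x)) := by rw [lp.coeFn_smul]; exact (hx.const_smul (r : ℂ))
  refine lp.ext ?_
  rw [lp.coeFn_smul, coe_linOp_of_rapidDecay hUv hPn hrx, coe_linOp_of_rapidDecay hUv hPn hx,
    lp.coeFn_smul]
  have hsm : wmul (-2) (r • ⇑x) = (r : ℂ) • wmul (-2) ⇑x := by
    funext k
    simp only [wmul_apply, Pi.smul_apply, ← Complex.coe_smul, smul_smul, mul_comm]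
  rw [hsm, linCoeff_smul]
  funext k
  simp only [wmul_apply, Pi.smul_apply, map_smul, ← Complex.coe_smul, smul_smul, mul_comm]

/-! ## §2 `w ↦ linOp (P_n w)` is bounded -/

omit [DecidableEq d] in
/-- **The level-`n` linearised field is bounded**: `‖linOp (P_n w)‖ ≤ K_lin·R_n·‖w‖` with
`R_n = ∑_{k ∈ cube n} ⟨k⟩² + 1` (weight ratio on the cube) and `K_lin` the constant of
`TransportGalerkinContinuity.eNorm_two_linCoeff_le`. -/
theorem norm_linOp_cubeProj_le [DecidableEq d] (hUv : RapidDecay Uv) (hπ : ∀ j, ‖π j‖ ≤ 1)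
    (hPn : ∀ k, ‖P k‖ ≤ 1) (n : ℕ) :
    ∃ C : ℝ, ∀ w : lp (fun _ : (d → ℤ) => V) 2, ‖linOp ν Uv π P (cubeProj n w)‖ ≤ C * ‖w‖ := by
  obtain ⟨K, hK⟩ : ∃ K : ℝ≥0∞, K =
      ‖(ν : ℂ)‖ₑ * ((Fintype.card d : ℝ≥0∞) * (ENNReal.ofReal (2 * Real.pi) * ENNReal.ofReal (2 * Real.pi)))
        + (∑ j, ENNReal.ofReal ((2 : ℝ) ^ (|(2 : ℝ)| / 2)) *
            symbNorm |(2 : ℝ)| (scal (fun p => π j (Uv p)) : (d → ℤ) → (V →L[ℂ] V))) * ENNReal.ofReal (2 * Real.pi)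
        + 2 * ((Fintype.card d : ℝ≥0∞) * ENNReal.ofReal (2 * Real.pi)) *
            (∑' l, ENNReal.ofReal (sobolevWeight 3 l) * ‖Uv l‖ₑ) := ⟨_, rfl⟩
  have hKfin : K < ∞ := hK ▸ linConst_lt_top hUv
  set Kc := Fintype.piFinset (fun _ : d => Finset.Icc (-(n : ℤ)) n) with hKc
  set R : ℝ := ∑ k ∈ Kc, sobolevWeight 2 k + 1 with hR
  have hR0 : 0 ≤ R := add_nonneg (Finset.sum_nonneg fun k _ => (sobolevWeight_pos 2 k).le) zero_le_one
  have hKR : ∀ k ∈ Kc, sobolevWeight (2 - 0) k ≤ R := fun k hk => by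
    rw [sub_zero, hR]
    have := Finset.single_le_sum (f := fun k => sobolevWeight 2 k) (fun k _ => (sobolevWeight_pos 2 k).le) hk
    linarith
  refine ⟨K.toReal * R, fun w => ?_⟩
  have hz : RapidDecay (⇑(cubeProj n w)) := rapidDecay_coe_cubeProj n w
  -- `‖linOp z‖² ≤ (K · R · ‖w‖)²` in `ℝ≥0∞`
  have h1 : eNormSq 0 (⇑(linOp ν Uv π P (cubeProj n w))) ≤ (K * (ENNReal.ofReal R * eNorm 0 (⇑w))) ^ 2 := by
    rw [coe_linOp_of_rapidDecay hUv hPn hz, eNormSq_wmul, zero_add]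
    refine (eNormSq_apply_le_of_opNorm_le_one P hPn 2 _).trans ?_
    rw [← eNorm_pow_two]
    refine pow_le_pow_left' ((hK ▸ eNorm_two_linCoeff_le hπ _).trans (mul_le_mul_right ?_ _)) 2
    -- `‖Λ⁻² ⇑z‖₄ = ‖⇑z‖₂ ≤ R ‖⇑w‖₀`
    rw [eNorm_wmul, show (4 : ℝ) + -2 = 2 by norm_num, coe_cubeProj]
    have h := eNormSq_trunc_le_mul_of_weight_le (weight_le_mul_of_le hKR) (⇑w)
    refine (ENNReal.pow_le_pow_left_iff two_ne_zero).1 ?_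
    rw [mul_pow, eNorm_pow_two, eNorm_pow_two, ← ENNReal.ofReal_pow hR0]
    exact h
  have hsq : eNormSq 0 (⇑w) = ENNReal.ofReal (‖w‖ ^ 2) := by
    rw [norm_sq_eq_toReal_eNormSq_zero, ENNReal.ofReal_toReal (eNormSq_zero_coe_lt_top w).ne]
  have hw0 : eNorm 0 (⇑w) = ENNReal.ofReal ‖w‖ := by
    have h2 : eNorm 0 (⇑w) ^ 2 = ENNReal.ofReal ‖w‖ ^ 2 := by
      rw [eNorm_pow_two, hsq, ENNReal.ofReal_pow (norm_nonneg _)]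
    exact le_antisymm ((ENNReal.pow_le_pow_left_iff two_ne_zero).1 h2.le)
      ((ENNReal.pow_le_pow_left_iff two_ne_zero).1 h2.ge)
  have hfin : (K * (ENNReal.ofReal R * eNorm 0 (⇑w))) ^ 2 ≠ ∞ := by
    rw [hw0]
    exact ENNReal.pow_ne_top (ENNReal.mul_ne_top hKfin.ne
      (ENNReal.mul_ne_top ENNReal.ofReal_ne_top ENNReal.ofReal_ne_top))
  have h2 := ENNReal.toReal_mono hfin h1
  rw [← norm_sq_eq_toReal_eNormSq_zero, hw0, ENNReal.toReal_pow, ENNReal.toReal_mul, ENNReal.toReal_mul,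
    ENNReal.toReal_ofReal hR0, ENNReal.toReal_ofReal (norm_nonneg _), ← mul_assoc] at h2
  exact (pow_le_pow_iff_left₀ (norm_nonneg _) (by positivity) two_ne_zero).1 h2

/-! ## §3 The level generators exist; KEEP/KILL without the `A_n` hypothesis -/

/-- **The level-`n` linearised field as a bounded real-linear map.** -/
theorem exists_linOp_level (hUv : RapidDecay Uv) (hπ : ∀ j, ‖π j‖ ≤ 1) (hPn : ∀ k, ‖P k‖ ≤ 1) (n : ℕ) :
    ∃ L : lp (fun _ : (d → ℤ) => V) 2 →L[ℝ] lp (fun _ : (d → ℤ) => V) 2,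
      ∀ w, L w = linOp ν Uv π P (cubeProj n w) := by
  obtain ⟨C, hC⟩ := norm_linOp_cubeProj_le (ν := ν) hUv hπ hPn n
  refine ⟨LinearMap.mkContinuous
    { toFun := fun w => linOp ν Uv π P (cubeProj n w)
      map_add' := fun x y => by
        simp only [map_add]
        exact linOp_add_of_rapidDecay hUv hPn (rapidDecay_coe_cubeProj n x) (rapidDecay_coe_cubeProj n y)
      map_smul' := fun r x => by
        simp only [map_smul, RingHom.id_apply]
        exact linOp_smul_of_rapidDecay hUv hPn r (rapidDecay_coe_cubeProj n x) } C hC, fun w => rfl⟩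

/-- **(r1) DISCHARGED: the μ-extended level generators exist as bounded real-linear maps**,
`A_n w = P_n (linOp (P_n w)) + μ (w − P_n w)`. -/
theorem exists_levelGenerators (hUv : RapidDecay Uv) (hπ : ∀ j, ‖π j‖ ≤ 1) (hPn : ∀ k, ‖P k‖ ≤ 1)
    (μ : ℝ) :
    ∃ An : ℕ → lp (fun _ : (d → ℤ) => V) 2 →L[ℝ] lp (fun _ : (d → ℤ) => V) 2,
      ∀ n, ∀ w : lp (fun _ : (d → ℤ) => V) 2,
        An n w = cubeProj n (linOp ν Uv π P (cubeProj n w)) + ((μ : ℂ) • (w - cubeProj n w)) := by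
  choose L hL using fun n => exists_linOp_level (ν := ν) hUv hπ hPn n
  refine ⟨fun n => (cubeProj n).comp (L n) +
    μ • (ContinuousLinearMap.id ℝ _ - cubeProj n), fun n w => ?_⟩
  change cubeProj n (L n w) + μ • (w - cubeProj n w) = _
  rw [hL]
  congr 1

end Summit.NavierStokesRegularity.FluidComputer.TransportGalerkinLevelGenerators

end
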